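import Literature.Topology.FourManifolds.MMSWRasmussenFacts
import Literature.Topology.FourManifolds.SliceDiscExteriorMeridian
import Literature.Topology.FourManifolds.SmallSetComplement
import Summits.SmoothPoincare4.SmoothPoincare4.Theorems.DottedCircleRasmussenDcrGapHelperFriendsCarrierExterior

/-!
# Aux file of helper `helper_friendsPi1_G2` (stub `stub_friendsPi1`, line `mk_friends`, crux `DcrGap`):
# the model disc exterior and its tube — point-set facts
(item stmt-SmoothPoincare4-16128, route route-SmoothPoincare4-DottedCircleRasmussen)

Setting of the Kervaire lemma for the MODEL DISC EXTERIOR (sub-goal G2 of stub B `stub_friendsPi1`):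
`D_k = MMSW.modelHandlebody k ⊂ ℝ⁴` the model dotted handlebody, `Δ₁ = f₁(𝔻²)` a model slice disc
of a model knot `K₁ ⊂ ∂D_k` (`MMSW.IsModelSliceDisc k K₁ f₁`, `MMSW.IsModelKnot k K₁`), and a
trivialised tube `T : D̊² × B(0,2) → ℝ⁴ ∖ D_k` of the open disc (`C^∞`, injective and immersive on
`dom = D̊² × B(0,2)`, `T(x, 0) = f₁ x`).  The exterior is `E = {x | x ∉ D_k ∧ x ∉ Δ₁}`.  This file is the
port to this setting of the point-set part of the tree's `SliceDiscExteriorMeridian.lean` /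
`SliceDiscEndCollar.lean` (there: `k = 0`, ambient the open unit ball, `ConicalDiscTube`), proved from
the unbundled hypotheses of the helper's signature:

* `FriendsPi1G2.isOpen_image_of_isOpen` — `T` is open on `dom` (inverse function theorem), so the tube
  `T(dom)` is open; `FriendsPi1G2.continuousOn_invFunOn` — its inverse is continuous on `T(dom)`;
* `FriendsPi1G2.mem_exterior_or_mem_image` — **the cover** `ℝ⁴ ∖ D_k = E ∪ T(dom)` (a point of `Δ₁`
  off `D_k` is `f₁ x = T(x, 0)` with `‖x‖ < 1`, because `f₁(∂𝔻²) = K₁(S¹) ⊆ ∂D_k ⊆ D_k`);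
* `FriendsPi1G2.apply_mem_exterior_iff` — **the punctured tube** `E ∩ T(dom) = T(D̊² × (B(0,2) ∖ 0))`
  (injectivity of `T` on `dom`); `FriendsPi1G2.isPathConnected_image_inter_exterior` — it is path
  connected;
* `FriendsPi1G2.isPathConnected_exterior` — **`E` is path connected**: `ℝ⁴ ∖ D_k` is path connected
  (hypothesis `SimplyConnectedSpace {x // x ∉ D_k}`, sub-goal G1) and `E` is its complement of the
  relatively closed `C^∞` image `f₁(D̊²)` of the `2`-dimensional disc — general position in codimension
  `2`, the tree's `isPathConnected_compl_of_subset_iUnion_image` (Hurewicz–Wallman Thm. IV 4) in the open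
  submanifold `ℝ⁴ ∖ D_k`;
* `helper_friendsPi1_G2_cover` — the registered conjunction of these facts.

No definitions, no named facts, no `sorry`.

## References

* C. Manolescu, L. Piccirillo, J. Lond. Math. Soc. (2) 108 (2023), §3.2, proof of Lemma 3.3. [ManolescuPiccirillo2023]
* W. Hurewicz, H. Wallman, *Dimension Theory* (1941), Ch. IV §5, Thm. IV 4. [HurewiczWallman1941]
-/

-- the prescribed namespace `Summit.<P>.<Sub>.…` duplicates `SmoothPoincare4` (P = Sub)
set_option linter.dupNamespace false
set_option linter.style.longLine false

noncomputable section

open scoped Manifold ContDiff Topology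
open Function Set Metric
open Literature.Topology.FourManifolds Literature.Topology.FourManifolds.MMSW

namespace Summit.SmoothPoincare4.SmoothPoincare4.Theorems.DcrGap.MkFriends

namespace FriendsPi1G2

/-! ## The tube is open and its inverse is continuous (inverse function theorem) -/

section Tube

variable {T : EuclideanSpace ℝ (Fin 2) × EuclideanSpace ℝ (Fin 2) → EuclideanSpace ℝ (Fin 4)}

/-- The tube domain is open. [folklore] -/
theorem isOpen_dom : IsOpen ((ball (0 : EuclideanSpace ℝ (Fin 2)) 1 ×ˢ ball (0 : EuclideanSpace ℝ (Fin 2)) 2) : Set (EuclideanSpace ℝ (Fin 2) × EuclideanSpace ℝ (Fin 2))) := isOpen_ball.prod isOpen_ball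

/-- **An injective immersion of an open subset of `ℝ² × ℝ²` into `ℝ⁴` is open**: `T` maps open subsets
of `dom` to open sets (its derivative is a linear isomorphism by the dimension count, inverse function
theorem `HasStrictFDerivAt.map_nhds_eq_of_equiv`). [folklore] -/
-- adapted from SliceDiscEndCollar.lean (`ConicalDiscTube.isOpen_image`)
theorem isOpen_image_of_isOpen (hTd : ContDiffOn ℝ ∞ T (ball (0 : EuclideanSpace ℝ (Fin 2)) 1 ×ˢ ball (0 : EuclideanSpace ℝ (Fin 2)) 2))
    (hTf : ∀ q ∈ (ball (0 : EuclideanSpace ℝ (Fin 2)) 1 ×ˢ ball (0 : EuclideanSpace ℝ (Fin 2)) 2), Injective (fderiv ℝ T q)) {W : Set (EuclideanSpace ℝ (Fin 2) × EuclideanSpace ℝ (Fin 2))} (hW : IsOpen W) (hWd : W ⊆ (ball (0 : EuclideanSpace ℝ (Fin 2)) 1 ×ˢ ball (0 : EuclideanSpace ℝ (Fin 2)) 2)) :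
    IsOpen (T '' W) := by
  rw [isOpen_iff_mem_nhds]
  rintro _ ⟨q, hq, rfl⟩
  have hinj := hTf q (hWd hq)
  let L : (EuclideanSpace ℝ (Fin 2) × EuclideanSpace ℝ (Fin 2)) ≃L[ℝ] (EuclideanSpace ℝ (Fin 4)) :=
    (LinearEquiv.ofBijective (fderiv ℝ T q).toLinearMap
      ⟨hinj, (LinearMap.injective_iff_surjective_of_finrank_eq_finrank (by simp)).1 hinj⟩).toContinuousLinearEquiv
  have hL : (L : (EuclideanSpace ℝ (Fin 2) × EuclideanSpace ℝ (Fin 2)) →L[ℝ] (EuclideanSpace ℝ (Fin 4))) = fderiv ℝ T q := ContinuousLinearMap.ext fun _ ↦ rfl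
  have hstrict : HasStrictFDerivAt T (L : (EuclideanSpace ℝ (Fin 2) × EuclideanSpace ℝ (Fin 2)) →L[ℝ] (EuclideanSpace ℝ (Fin 4))) q := by
    rw [hL]
    exact (hTd.contDiffAt (isOpen_dom.mem_nhds (hWd hq))).hasStrictFDerivAt (by simp)
  rw [← hstrict.map_nhds_eq_of_equiv]
  exact Filter.image_mem_map (hW.mem_nhds hq)

/-- The tube `T(dom)` is open. [folklore] -/
theorem isOpen_image_dom (hTd : ContDiffOn ℝ ∞ T (ball (0 : EuclideanSpace ℝ (Fin 2)) 1 ×ˢ ball (0 : EuclideanSpace ℝ (Fin 2)) 2)) (hTf : ∀ q ∈ (ball (0 : EuclideanSpace ℝ (Fin 2)) 1 ×ˢ ball (0 : EuclideanSpace ℝ (Fin 2)) 2), Injective (fderiv ℝ T q)) :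
    IsOpen (T '' (ball (0 : EuclideanSpace ℝ (Fin 2)) 1 ×ˢ ball (0 : EuclideanSpace ℝ (Fin 2)) 2)) :=
  isOpen_image_of_isOpen hTd hTf isOpen_dom Subset.rfl

/-- **The inverse of the tube is continuous on `T(dom)`** (an injective open map). [folklore] -/
theorem continuousOn_invFunOn (hTd : ContDiffOn ℝ ∞ T (ball (0 : EuclideanSpace ℝ (Fin 2)) 1 ×ˢ ball (0 : EuclideanSpace ℝ (Fin 2)) 2)) (hTi : InjOn T (ball (0 : EuclideanSpace ℝ (Fin 2)) 1 ×ˢ ball (0 : EuclideanSpace ℝ (Fin 2)) 2))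
    (hTf : ∀ q ∈ (ball (0 : EuclideanSpace ℝ (Fin 2)) 1 ×ˢ ball (0 : EuclideanSpace ℝ (Fin 2)) 2), Injective (fderiv ℝ T q)) : ContinuousOn (invFunOn T (ball (0 : EuclideanSpace ℝ (Fin 2)) 1 ×ˢ ball (0 : EuclideanSpace ℝ (Fin 2)) 2)) (T '' (ball (0 : EuclideanSpace ℝ (Fin 2)) 1 ×ˢ ball (0 : EuclideanSpace ℝ (Fin 2)) 2)) := by
  refine IsOpenMap.continuousOn_image_of_leftInvOn (fun W hW ↦ ?_) hTi.leftInvOn_invFunOn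
  obtain ⟨W', hW', rfl⟩ := isOpen_induced_iff.1 hW
  rw [restrict_eq, image_comp, Subtype.image_preimage_coe]
  exact isOpen_image_of_isOpen hTd hTf (isOpen_dom.inter hW') inter_subset_left

/-- The punctured plane squeezed onto the punctured disc: `B(0,2) ∖ 0 = κ(ℝ² ∖ 0)` for the radial
squeeze `κ w = 2w/(1 + ‖w‖)` of `SliceDiscExteriorMeridian.lean`. [folklore] -/
theorem ball_diff_zero_eq_image_kap :
    ball (0 : EuclideanSpace ℝ (Fin 2)) 2 \ {0} = ConicalDiscTube.kap '' {0}ᶜ := by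
  ext w
  simp only [mem_sdiff, mem_ball_zero_iff, mem_singleton_iff, mem_image, mem_compl_iff]
  constructor
  · rintro ⟨hw, hw0⟩
    exact ⟨ConicalDiscTube.kapInv w, ConicalDiscTube.kapInv_ne_zero hw hw0, ConicalDiscTube.kap_kapInv hw⟩
  · rintro ⟨u, hu, rfl⟩
    exact ⟨ConicalDiscTube.norm_kap_lt u, ConicalDiscTube.kap_ne_zero hu⟩

/-- The punctured disc `B(0,2) ∖ 0 ⊆ ℝ²` is path connected. [folklore] -/
theorem isPathConnected_ball_diff_zero : IsPathConnected (ball (0 : EuclideanSpace ℝ (Fin 2)) 2 \ {0}) := by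
  have hrank : 1 < Module.rank ℝ (EuclideanSpace ℝ (Fin 2)) := by
    rw [← Module.finrank_eq_rank, finrank_euclideanSpace, Fintype.card_fin]
    norm_num
  rw [ball_diff_zero_eq_image_kap]
  exact (isPathConnected_compl_singleton_of_one_lt_rank hrank 0).image ConicalDiscTube.continuous_kap

/-- **The punctured tube `T(D̊² × (B(0,2) ∖ 0))` is path connected.** [folklore] -/
-- adapted from SliceDiscExteriorMeridian.lean (`ConicalDiscTube.isPathConnected_N_inter_O`)
theorem isPathConnected_image_punctured (hTd : ContDiffOn ℝ ∞ T (ball (0 : EuclideanSpace ℝ (Fin 2)) 1 ×ˢ ball (0 : EuclideanSpace ℝ (Fin 2)) 2)) :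
    IsPathConnected (T '' (ball (0 : EuclideanSpace ℝ (Fin 2)) 1 ×ˢ (ball (0 : EuclideanSpace ℝ (Fin 2)) 2 \ {0}))) := by
  refine ((convex_ball (0 : EuclideanSpace ℝ (Fin 2)) 1).isPathConnected ⟨0, by simp⟩).prod isPathConnected_ball_diff_zero
    |>.image' (hTd.continuousOn.mono ?_)
  rintro ⟨x, w⟩ ⟨hx, hw, -⟩
  exact ⟨hx, hw⟩

end Tube

/-! ## The cover `ℝ⁴ ∖ D_k = E ∪ T(dom)` and the punctured tube `E ∩ T(dom)` -/

section Cover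

variable {k : ℕ} {K₁ : (Metric.sphere (0 : EuclideanSpace ℝ (Fin 2)) 1) → EuclideanSpace ℝ (Fin 4)} {f₁ : EuclideanSpace ℝ (Fin 2) → EuclideanSpace ℝ (Fin 4)}
  {T : EuclideanSpace ℝ (Fin 2) × EuclideanSpace ℝ (Fin 2) → EuclideanSpace ℝ (Fin 4)}

/-- The boundary circle of a model slice disc lies in the model handlebody: `f₁ x = K₁ x ∈ ∂D_k ⊆ D_k`
for `‖x‖ = 1`. [folklore] -/
theorem apply_mem_modelHandlebody_of_norm_eq_one (hK : IsModelKnot k K₁) (hf : IsModelSliceDisc k K₁ f₁)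
    {x : EuclideanSpace ℝ (Fin 2)} (hx : ‖x‖ = 1) : f₁ x ∈ modelHandlebody k := by
  have h := hf.apply_sphere ⟨x, mem_sphere_zero_iff_norm.2 hx⟩
  rw [Subtype.coe_mk] at h
  rw [h]
  exact modelBoundary_subset_modelHandlebody (hK.mem _)

/-- A point of the disc `Δ₁ = f₁(𝔻²)` off `D_k` is an interior point `f₁ x`, `‖x‖ < 1`. [folklore] -/
theorem exists_norm_lt_one_of_mem_image (hK : IsModelKnot k K₁) (hf : IsModelSliceDisc k K₁ f₁) {z : EuclideanSpace ℝ (Fin 4)}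
    (hzD : z ∉ modelHandlebody k) (hz : z ∈ f₁ '' closedBall (0 : EuclideanSpace ℝ (Fin 2)) 1) : ∃ x : EuclideanSpace ℝ (Fin 2), ‖x‖ < 1 ∧ f₁ x = z := by
  obtain ⟨x, hx, rfl⟩ := hz
  rw [mem_closedBall, dist_zero_right] at hx
  rcases hx.lt_or_eq with hlt | heq
  · exact ⟨x, hlt, rfl⟩
  · exact absurd (apply_mem_modelHandlebody_of_norm_eq_one hK hf heq) hzD

/-- **The cover**: a point off `D_k` lies in the exterior `E` or in the tube `T(dom)` (a disc point off
`D_k` is on the zero section, `f₁ x = T(x, 0)`). [folklore] -/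
-- adapted from SliceDiscExteriorMeridian.lean (`ConicalDiscTube.ball_subset_N_union_O`)
theorem mem_exterior_or_mem_image (hK : IsModelKnot k K₁) (hf : IsModelSliceDisc k K₁ f₁)
    (hT0 : ∀ x ∈ ball (0 : EuclideanSpace ℝ (Fin 2)) 1, T (x, 0) = f₁ x) {z : EuclideanSpace ℝ (Fin 4)} (hzD : z ∉ modelHandlebody k) :
    z ∈ {x : EuclideanSpace ℝ (Fin 4) | x ∉ modelHandlebody k ∧ x ∉ f₁ '' closedBall (0 : EuclideanSpace ℝ (Fin 2)) 1} ∨ z ∈ T '' (ball (0 : EuclideanSpace ℝ (Fin 2)) 1 ×ˢ ball (0 : EuclideanSpace ℝ (Fin 2)) 2) := by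
  by_cases hz : z ∈ f₁ '' closedBall (0 : EuclideanSpace ℝ (Fin 2)) 1
  · obtain ⟨x, hx, rfl⟩ := exists_norm_lt_one_of_mem_image hK hf hzD hz
    refine Or.inr ⟨(x, 0), ⟨mem_ball_zero_iff.2 hx, by simp⟩, hT0 x (mem_ball_zero_iff.2 hx)⟩
  · exact Or.inl ⟨hzD, hz⟩

/-- **The punctured tube, pointwise**: for `q ∈ dom`, `T q` lies in the exterior `E` iff `q` is off the
zero section (`T(dom)` misses `D_k`; a disc point `f₁ y` equal to `T q` has `‖y‖ < 1`, so
`T q = T(y, 0)` and `q = (y, 0)` by injectivity). [folklore] -/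
-- adapted from SliceDiscExteriorMeridian.lean (`ConicalDiscTube.N_inter_O_eq`)
theorem apply_mem_exterior_iff (hK : IsModelKnot k K₁) (hf : IsModelSliceDisc k K₁ f₁) (hTi : InjOn T (ball (0 : EuclideanSpace ℝ (Fin 2)) 1 ×ˢ ball (0 : EuclideanSpace ℝ (Fin 2)) 2))
    (hTD : ∀ q ∈ (ball (0 : EuclideanSpace ℝ (Fin 2)) 1 ×ˢ ball (0 : EuclideanSpace ℝ (Fin 2)) 2), T q ∉ modelHandlebody k) (hT0 : ∀ x ∈ ball (0 : EuclideanSpace ℝ (Fin 2)) 1, T (x, 0) = f₁ x)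
    {q : EuclideanSpace ℝ (Fin 2) × EuclideanSpace ℝ (Fin 2)} (hq : q ∈ ((ball (0 : EuclideanSpace ℝ (Fin 2)) 1 ×ˢ ball (0 : EuclideanSpace ℝ (Fin 2)) 2) : Set (EuclideanSpace ℝ (Fin 2) × EuclideanSpace ℝ (Fin 2)))) :
    T q ∈ {x : EuclideanSpace ℝ (Fin 4) | x ∉ modelHandlebody k ∧ x ∉ f₁ '' closedBall (0 : EuclideanSpace ℝ (Fin 2)) 1} ↔ q.2 ≠ 0 := by
  obtain ⟨x, w⟩ := q
  have hx : x ∈ ball (0 : EuclideanSpace ℝ (Fin 2)) 1 := hq.1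
  have hw : w ∈ ball (0 : EuclideanSpace ℝ (Fin 2)) 2 := hq.2
  constructor
  · rintro ⟨-, hdisc⟩ hw0
    change w = 0 at hw0
    subst hw0
    exact hdisc ⟨x, ball_subset_closedBall hx, (hT0 x hx).symm⟩
  · intro hw0
    refine ⟨hTD _ hq, fun hdisc ↦ hw0 ?_⟩
    obtain ⟨y, hy, hyq⟩ := exists_norm_lt_one_of_mem_image hK hf (hTD _ hq) hdisc
    rw [← hT0 y (mem_ball_zero_iff.2 hy)] at hyq
    have hy0 : ((y, (0 : EuclideanSpace ℝ (Fin 2))) : EuclideanSpace ℝ (Fin 2) × EuclideanSpace ℝ (Fin 2)) ∈ ((ball (0 : EuclideanSpace ℝ (Fin 2)) 1 ×ˢ ball (0 : EuclideanSpace ℝ (Fin 2)) 2) : Set (EuclideanSpace ℝ (Fin 2) × EuclideanSpace ℝ (Fin 2))) :=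
      ⟨mem_ball_zero_iff.2 hy, mem_ball_self two_pos⟩
    have := hTi hy0 hq hyq
    exact ((Prod.ext_iff.1 this).2).symm

/-- **The punctured tube as a set**: `T(dom) ∩ E = T(D̊² × (B(0,2) ∖ 0))`. [folklore] -/
theorem image_inter_exterior_eq (hK : IsModelKnot k K₁) (hf : IsModelSliceDisc k K₁ f₁) (hTi : InjOn T (ball (0 : EuclideanSpace ℝ (Fin 2)) 1 ×ˢ ball (0 : EuclideanSpace ℝ (Fin 2)) 2))
    (hTD : ∀ q ∈ (ball (0 : EuclideanSpace ℝ (Fin 2)) 1 ×ˢ ball (0 : EuclideanSpace ℝ (Fin 2)) 2), T q ∉ modelHandlebody k) (hT0 : ∀ x ∈ ball (0 : EuclideanSpace ℝ (Fin 2)) 1, T (x, 0) = f₁ x) :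
    T '' (ball (0 : EuclideanSpace ℝ (Fin 2)) 1 ×ˢ ball (0 : EuclideanSpace ℝ (Fin 2)) 2) ∩ {x : EuclideanSpace ℝ (Fin 4) | x ∉ modelHandlebody k ∧ x ∉ f₁ '' closedBall (0 : EuclideanSpace ℝ (Fin 2)) 1} =
      T '' (ball (0 : EuclideanSpace ℝ (Fin 2)) 1 ×ˢ (ball (0 : EuclideanSpace ℝ (Fin 2)) 2 \ {0})) := by
  ext z
  constructor
  · rintro ⟨⟨q, hq, rfl⟩, hE⟩
    exact ⟨q, ⟨hq.1, hq.2, (apply_mem_exterior_iff hK hf hTi hTD hT0 hq).1 hE⟩, rfl⟩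
  · rintro ⟨q, ⟨hq1, hq2, hq0⟩, rfl⟩
    exact ⟨⟨q, ⟨hq1, hq2⟩, rfl⟩, (apply_mem_exterior_iff hK hf hTi hTD hT0 ⟨hq1, hq2⟩).2 hq0⟩

/-- **The punctured tube `T(dom) ∩ E` is path connected.** [folklore] -/
theorem isPathConnected_image_inter_exterior (hK : IsModelKnot k K₁) (hf : IsModelSliceDisc k K₁ f₁)
    (hTd : ContDiffOn ℝ ∞ T (ball (0 : EuclideanSpace ℝ (Fin 2)) 1 ×ˢ ball (0 : EuclideanSpace ℝ (Fin 2)) 2)) (hTi : InjOn T (ball (0 : EuclideanSpace ℝ (Fin 2)) 1 ×ˢ ball (0 : EuclideanSpace ℝ (Fin 2)) 2)) (hTD : ∀ q ∈ (ball (0 : EuclideanSpace ℝ (Fin 2)) 1 ×ˢ ball (0 : EuclideanSpace ℝ (Fin 2)) 2), T q ∉ modelHandlebody k)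
    (hT0 : ∀ x ∈ ball (0 : EuclideanSpace ℝ (Fin 2)) 1, T (x, 0) = f₁ x) :
    IsPathConnected (T '' (ball (0 : EuclideanSpace ℝ (Fin 2)) 1 ×ˢ ball (0 : EuclideanSpace ℝ (Fin 2)) 2) ∩ {x : EuclideanSpace ℝ (Fin 4) | x ∉ modelHandlebody k ∧ x ∉ f₁ '' closedBall (0 : EuclideanSpace ℝ (Fin 2)) 1}) := by
  rw [image_inter_exterior_eq hK hf hTi hTD hT0]
  exact isPathConnected_image_punctured hTd

/-! ## The exterior is path connected (general position in `ℝ⁴ ∖ D_k`) -/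

/-- **The model disc exterior `E = ℝ⁴ ∖ (D_k ∪ Δ₁)` is path connected.**  In the connected open
submanifold `M = ℝ⁴ ∖ D_k` (path connected: `SimplyConnectedSpace {x // x ∉ D_k}`) the trace of `Δ₁` is
the relatively closed `C^∞` image `f₁(D̊²)` of the `2`-disc (`f₁(∂𝔻²) ⊆ D_k`), of codimension `2`, whose
complement is path connected by general position (`isPathConnected_compl_of_subset_iUnion_image`,
Hurewicz–Wallman Thm. IV 4). [cite: HurewiczWallman1941, Ch. IV §5, Thm. IV 4 and Cor. 1] -/
-- replaces SliceDiscExteriorMeridian.lean `ConicalDiscTube.isPathConnected_O` (there by convexity of the ball)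
theorem isPathConnected_exterior (hK : IsModelKnot k K₁) (hf : IsModelSliceDisc k K₁ f₁)
    (hsc : SimplyConnectedSpace {x : EuclideanSpace ℝ (Fin 4) // x ∉ modelHandlebody k}) :
    IsPathConnected {x : EuclideanSpace ℝ (Fin 4) | x ∉ modelHandlebody k ∧ x ∉ f₁ '' closedBall (0 : EuclideanSpace ℝ (Fin 2)) 1} := by
  classical
  -- the ambient open submanifold `M = ℝ⁴ ∖ D_k`
  let M : TopologicalSpace.Opens (EuclideanSpace ℝ (Fin 4)) := ⟨(modelHandlebody k)ᶜ, (isClosed_modelHandlebody k).isOpen_compl⟩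
  haveI : PathConnectedSpace {x : EuclideanSpace ℝ (Fin 4) // x ∉ modelHandlebody k} := inferInstance
  haveI : PathConnectedSpace M := ‹PathConnectedSpace {x : EuclideanSpace ℝ (Fin 4) // x ∉ modelHandlebody k}›
  -- the trace of the disc
  let S : Set M := {y | (y : EuclideanSpace ℝ (Fin 4)) ∈ f₁ '' closedBall (0 : EuclideanSpace ℝ (Fin 2)) 1}
  have hS : IsClosed S :=
    ((isCompact_closedBall (0 : EuclideanSpace ℝ (Fin 2)) 1).image hf.1.continuous).isClosed.preimage continuous_subtype_val
  -- its parametrisation by the open disc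
  let y₀ : M := ⟨f₁ 0, hf.apply_notMem (by simp)⟩
  let g : Unit → EuclideanSpace ℝ (Fin 2) → M := fun _ x ↦ if h : f₁ x ∉ modelHandlebody k then ⟨f₁ x, h⟩ else y₀
  have hgval : ∀ x ∈ ball (0 : EuclideanSpace ℝ (Fin 2)) 1, ((g () x : M) : EuclideanSpace ℝ (Fin 4)) = f₁ x := fun x hx ↦ by
    simp only [g, dif_pos (hf.apply_notMem (mem_ball_zero_iff.1 hx))]
  have hg : ∀ i, ContMDiffOn 𝓘(ℝ, EuclideanSpace ℝ (Fin 2)) 𝓘(ℝ, EuclideanSpace ℝ (Fin 4)) 1 (g i) (ball (0 : EuclideanSpace ℝ (Fin 2)) 1) := by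
    rintro ⟨⟩ x hx
    refine (ChartedSpace.liftPropWithinAt_subtypeVal_comp_iff (U := M) (g ()) (ball (0 : EuclideanSpace ℝ (Fin 2)) 1) x).1 ?_
    have h1 : ContMDiffWithinAt 𝓘(ℝ, EuclideanSpace ℝ (Fin 2)) 𝓘(ℝ, EuclideanSpace ℝ (Fin 4)) 1 f₁ (ball (0 : EuclideanSpace ℝ (Fin 2)) 1) x :=
      (hf.1.of_le (by exact_mod_cast le_top)).contMDiffAt.contMDiffWithinAt
    exact h1.congr (fun y hy ↦ hgval y hy) (hgval x hx)
  have hSsub : S ⊆ ⋃ i, g i '' ball (0 : EuclideanSpace ℝ (Fin 2)) 1 := by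
    intro y hy
    obtain ⟨x, hx, hxy⟩ := exists_norm_lt_one_of_mem_image hK hf y.2 hy
    refine mem_iUnion.2 ⟨(), x, mem_ball_zero_iff.2 hx, Subtype.ext ?_⟩
    rw [hgval x (mem_ball_zero_iff.2 hx), hxy]
  have hdim : Module.finrank ℝ (EuclideanSpace ℝ (Fin 2)) + 2 ≤ Module.finrank ℝ (EuclideanSpace ℝ (Fin 4)) := by simp
  have hpc : IsPathConnected Sᶜ :=
    isPathConnected_compl_of_subset_iUnion_image (I := 𝓘(ℝ, EuclideanSpace ℝ (Fin 4))) (M := M) hdim hS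
      (fun x _ ↦ BoundarylessManifold.isInteriorPoint) g (fun _ ↦ ball (0 : EuclideanSpace ℝ (Fin 2)) 1) (fun _ ↦ isOpen_ball)
      hg hSsub
  -- read in `ℝ⁴`
  have himage : Subtype.val '' Sᶜ = {x : EuclideanSpace ℝ (Fin 4) | x ∉ modelHandlebody k ∧ x ∉ f₁ '' closedBall (0 : EuclideanSpace ℝ (Fin 2)) 1} := by
    ext z
    constructor
    · rintro ⟨y, hy, rfl⟩
      exact ⟨y.2, hy⟩
    · rintro ⟨hzD, hz⟩
      exact ⟨⟨z, hzD⟩, hz, rfl⟩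
  rw [← himage]
  exact hpc.image continuous_subtype_val

end Cover

end FriendsPi1G2

/-- **Helper `helper_friendsPi1_G2_cover`** (registered piece of `helper_friendsPi1_G2`): the point-set
facts of the van Kampen cover `ℝ⁴ ∖ D_k = E ∪ T(dom)` for the model disc exterior
`E = {x | x ∉ D_k ∧ x ∉ f₁(𝔻²)}` with a trivialised tube `T` of the open disc — `T(dom)` is open with
continuous inverse, `E` is path connected, every point off `D_k` is in `E` or in `T(dom)`, a tube point
`T q` is in `E` iff `q.2 ≠ 0`, and the punctured tube `T(dom) ∩ E` is path connected.
[cite: ManolescuPiccirillo2023, §3.2, proof of Lemma 3.3] -/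
theorem helper_friendsPi1_G2_cover : ∀ (k : ℕ) (K₁ : (Metric.sphere (0 : EuclideanSpace ℝ (Fin 2)) 1) → EuclideanSpace ℝ (Fin 4)) (f₁ : EuclideanSpace ℝ (Fin 2) → EuclideanSpace ℝ (Fin 4)) (T : EuclideanSpace ℝ (Fin 2) × EuclideanSpace ℝ (Fin 2) → EuclideanSpace ℝ (Fin 4)), Literature.Topology.FourManifolds.MMSW.IsModelKnot k K₁ → Literature.Topology.FourManifolds.MMSW.IsModelSliceDisc k K₁ f₁ → (ContDiffOn ℝ ((⊤ : ℕ∞) : WithTop ℕ∞) T (Metric.ball (0 : EuclideanSpace ℝ (Fin 2)) 1 ×ˢ Metric.ball (0 : EuclideanSpace ℝ (Fin 2)) 2) ∧ Set.InjOn T (Metric.ball (0 : EuclideanSpace ℝ (Fin 2)) 1 ×ˢ Metric.ball (0 : EuclideanSpace ℝ (Fin 2)) 2) ∧ (∀ q ∈ Metric.ball (0 : EuclideanSpace ℝ (Fin 2)) 1 ×ˢ Metric.ball (0 : EuclideanSpace ℝ (Fin 2)) 2, Function.Injective (fderiv ℝ T q)) ∧ (∀ q ∈ Metric.ball (0 :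 EuclideanSpace ℝ (Fin 2)) 1 ×ˢ Metric.ball (0 : EuclideanSpace ℝ (Fin 2)) 2, T q ∉ Literature.Topology.FourManifolds.MMSW.modelHandlebody k) ∧ (∀ x ∈ Metric.ball (0 : EuclideanSpace ℝ (Fin 2)) 1, T (x, 0) = f₁ x)) → SimplyConnectedSpace {x : EuclideanSpace ℝ (Fin 4) // x ∉ Literature.Topology.FourManifolds.MMSW.modelHandlebody k} → IsOpen (T '' (Metric.ball (0 : EuclideanSpace ℝ (Fin 2)) 1 ×ˢ Metric.ball (0 : EuclideanSpace ℝ (Fin 2)) 2)) ∧ ContinuousOn (Function.invFunOn T (Metric.ball (0 : EuclideanSpace ℝ (Fin 2)) 1 ×ˢ Metric.ball (0 : EuclideanSpace ℝ (Fin 2)) 2)) (T '' (Metric.ball (0 : EuclideanSpace ℝ (Fin 2)) 1 ×ˢ Metric.ball (0 : EuclideanSpace ℝ (Fin 2)) 2)) ∧ IsPathConnected {x : EuclideanSpace ℝ (Fin 4) | x ∉ Literature.Topology.FourManifolds.MMSW.modelHandlebody k ∧ x ∉ f₁ '' Metric.closedBall (0 : EuclideanSpace ℝ (Fin 2)) 1}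 ∧ (∀ z : EuclideanSpace ℝ (Fin 4), z ∉ Literature.Topology.FourManifolds.MMSW.modelHandlebody k → z ∈ {x : EuclideanSpace ℝ (Fin 4) | x ∉ Literature.Topology.FourManifolds.MMSW.modelHandlebody k ∧ x ∉ f₁ '' Metric.closedBall (0 : EuclideanSpace ℝ (Fin 2)) 1} ∨ z ∈ T '' (Metric.ball (0 : EuclideanSpace ℝ (Fin 2)) 1 ×ˢ Metric.ball (0 : EuclideanSpace ℝ (Fin 2)) 2)) ∧ (∀ q ∈ Metric.ball (0 : EuclideanSpace ℝ (Fin 2)) 1 ×ˢ Metric.ball (0 : EuclideanSpace ℝ (Fin 2)) 2, T q ∈ {x : EuclideanSpace ℝ (Fin 4) | x ∉ Literature.Topology.FourManifolds.MMSW.modelHandlebody k ∧ x ∉ f₁ '' Metric.closedBall (0 : EuclideanSpace ℝ (Fin 2)) 1} ↔ q.2 ≠ 0) ∧ IsPathConnected (T '' (Metric.ball (0 : EuclideanSpace ℝ (Fin 2)) 1 ×ˢ Metric.ball (0 : EuclideanSpace ℝ (Fin 2)) 2) ∩ {x : EuclideanSpace ℝ (Fin 4) | x ∉ Literature.Topology.FourManifolds.MMSW.modelHandlebody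 k ∧ x ∉ f₁ '' Metric.closedBall (0 : EuclideanSpace ℝ (Fin 2)) 1}) := by
  rintro k K₁ f₁ T hK hf ⟨hTd, hTi, hTf, hTD, hT0⟩ hsc
  exact ⟨FriendsPi1G2.isOpen_image_dom hTd hTf, FriendsPi1G2.continuousOn_invFunOn hTd hTi hTf,
    FriendsPi1G2.isPathConnected_exterior hK hf hsc,
    fun z hz ↦ FriendsPi1G2.mem_exterior_or_mem_image hK hf hT0 hz,
    fun q hq ↦ FriendsPi1G2.apply_mem_exterior_iff hK hf hTi hTD hT0 hq,
    FriendsPi1G2.isPathConnected_image_inter_exterior hK hf hTd hTi hTD hT0⟩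

end Summit.SmoothPoincare4.SmoothPoincare4.Theorems.DcrGap.MkFriends

end
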